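import Literature.AlgebraicGeometry.Frobenioids.OneObjectAutForget
import Literature.AlgebraicGeometry.Frobenioids.GroupLikeStandardExample
import Literature.AlgebraicGeometry.Frobenioids.BaseCategoryTheoreticityDefs
import Literature.AlgebraicGeometry.Frobenioids.DivisorMonoidCategoryTheoreticityDefs
import Literature.AlgebraicGeometry.Frobenioids.PreFrobenioidDataOfFunctor
import Literature.AlgebraicGeometry.Frobenioids.DivSlimRemarkProofs
import HarnessLib

/-!
# Frobenioids I, Example 4.7 (i) (second claim) and Remark 4.11.2 (second half): a one-object base with
# trivial action on `Φ` is Frobenius-slim but NOT Div-slim — PROOF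

Mochizuki, *The geometry of Frobenioids I: the general theory*, Kyushu J. Math. **62** (2008) 293–400,
Example 4.7 (i), kurims text p. 87: "Suppose that the functor `Φ : D → 𝔐𝔬𝔫` maps every automorphism of `D` to an
identity automorphism of `𝔐𝔬𝔫`. Then it follows formally that `D` is Div-slim if and only if `D` is slim. In
particular, if, for instance, `D` is a one-object category, `A ∈ Ob(D)`, and `End_D(A)` is a nontrivial residually
finite group `G`, then `Aut(D_A → D) = Ker(Aut(D_A → D) → Aut(D_A → 𝔐𝔬𝔫)) = G` — so [cf. Remark 3.1.2] `D` is
Frobenius-slim, but not Div-slim." [cite: MochizukiFrdI2008, Ex. 4.7 (i) p.87]; Remark 4.11.2, p. 94: "in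
Example 3.10, since `G = Aut(D_A → D)` [where `A ∈ Ob(D)`] acts trivially on `ℤ_{≥0}`, it follows that `D` fails
to be Div-slim" [cite: MochizukiFrdI2008, Rem. 4.11.2 p.94].

PROOF-ONLY (seat abc-iut-L1-t3 gen 4, typer of Def. 3.1 (i) `IsFrobeniusSlim` / Def. 4.5 (iv)
`PreFrobenioidData.IsDivSlim` and of node FrdI:Ex4.7(i), whose FIRST claim is `isDivSlim_iff_isSlim_of_trivial_on_aut`
in `DivisorMonoidCategoryTheoreticityDefs.lean`). Over abc-iut-L1-t8's `SingleObjAut.autForgetMulEquiv :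
Aut(D_A → D) ≃* G` (`OneObjectAutForget.lean`) and Rem. 3.1.2 `isFrobeniusSlim_of_residuallyFinite`
(`BaseCategoryTheoreticityDefs.lean`):
* residual finiteness transports along `H ≃* G` — abc-iut-L1-t8's
  `Rmk4121.isResiduallyFiniteGroup_of_mulEquiv` (`DivSlimRemarkProofs.lean`, Rem. 4.12.1), cited not restated;
* `PreFrobenioidData.not_isDivSlim_singleObj_of_pull_eq_self` — for the one-object category `B(G)` of a
  NONTRIVIAL group `G` and the operations `S` of ANY pre-Frobenioid structure over it whose pull-backs along all
  arrows of `B(G)` are the identity ("`Φ` maps every automorphism of `D` to an identity"; e.g. the trivial monoid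
  `ℤ_{≥0}` of Example 3.10, `Rmk4112.pull_eq_self`), `D = B(G)` is NOT Div-slim — the automorphism `f ↦ f⁻¹ g f`
  of `D_A → D` (`g ≠ 1`) acts trivially on `Φ`;
* `B(G)` IS Frobenius-slim for `G` residually finite (Rem. 3.1.2 through `Aut(D_A → D) ≅ G`) = abc-iut-L1-t8's
  `Rmk4121.isFrobeniusSlim_D` (`DivSlimRemarkProofs.lean`; its base `Ex310.D G` is an `abbrev` of `SingleObj G`),
  cited not restated;
* `Ex47i_second_claim` — the conjunction, Example 4.7 (i) verbatim; `Rmk4112_second_half` — Remark 4.11.2 for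
  the base of Example 3.10.
No definitions; nothing here bears on [IUTchIII] or asserts anything about abc.
-/

namespace Literature.AlgebraicGeometry.Frobenioids

open CategoryTheory

universe w v u

namespace PreFrobenioidData

variable (G : Type) [Group G] {C : Type u} [Category.{v} C] (S : PreFrobenioidData.{w} C (SingleObj G))

/-- **Example 4.7 (i) / Remark 4.11.2, the negative clause**: if the pull-backs of `Φ` along ALL arrows of the
one-object category `D = B(G)` are identities ("`Φ` maps every automorphism of `D` to an identity automorphism")
and `G` is nontrivial, then `D` is NOT Div-slim relative to `Φ` (Def. 4.5 (iv)): for `1 ≠ g ∈ G` the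
automorphism `(A, f) ↦ f⁻¹ g f` of `D_A → D` is nontrivial but acts trivially on `Φ`. Stated for the
operations `S` of any (pre-)Frobenioid structure over `(D, Φ)`. [cite: MochizukiFrdI2008, Ex. 4.7 (i) p.87] -/
theorem not_isDivSlim_singleObj_of_pull_eq_self [Nontrivial G]
    (hS : ∀ (X : SingleObj G) (f : X ⟶ X) (x : S.Mon X), S.pull f x = x) : ¬ S.IsDivSlim := by
  intro h
  obtain ⟨g, hg⟩ := exists_ne (1 : G)
  have key : (SingleObjAut.autForgetMulEquiv G).symm g = 1 :=
    h.eq_one (SingleObj.star G) ((SingleObjAut.autForgetMulEquiv G).symm g) fun B x => hS _ _ x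
  apply hg
  have := congrArg (SingleObjAut.autForgetMulEquiv G) key
  rwa [MulEquiv.apply_symm_apply, map_one] at this

end PreFrobenioidData

/-- **Example 4.7 (i), second claim** (FrdI p. 87): for `D = B(G)` the one-object category of a nontrivial
residually finite group `G` and `Φ` trivial on (auto)morphisms, `D` is Frobenius-slim but not Div-slim —
for the operations `S` of any pre-Frobenioid structure over `(D, Φ)`. [cite: MochizukiFrdI2008, Ex. 4.7 (i) p.87] -/
theorem Ex47i_second_claim (G : Type) [Group G] [Nontrivial G] (hG : IsResiduallyFiniteGroup G)
    {C : Type u} [Category.{v} C] (S : PreFrobenioidData.{w} C (SingleObj G))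
    (hS : ∀ (X : SingleObj G) (f : X ⟶ X) (x : S.Mon X), S.pull f x = x) :
    IsFrobeniusSlim (SingleObj G) ∧ ¬ S.IsDivSlim :=
  ⟨Rmk4121.isFrobeniusSlim_D G hG,
    PreFrobenioidData.not_isDivSlim_singleObj_of_pull_eq_self G S hS⟩

/-- **Remark 4.11.2, second half** (FrdI p. 94): "in Example 3.10, since `G = Aut(D_A → D)` acts trivially on
`ℤ_{≥0}`, it follows that `D` fails to be Div-slim" — for the base `D = B(G)` (`G` nontrivial) carrying the
trivial monoid `ℤ_{≥0}` of Example 3.10 (abc-iut-L1-t8's `trivialMonoidOn`, action triviality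
`Rmk4112.pull_eq_self` being definitional), and the operations of any `C → F_Φ` over it.
[cite: MochizukiFrdI2008, Rem. 4.11.2 p.94] -/
theorem Rmk4112_second_half (G : Type) [Group G] [Nontrivial G] {C : Type u} [Category.{v} C]
    (F : C ⥤ ElemFrobenioid (trivialMonoidOn G (Multiplicative ℕ))) :
    ¬ (PreFrobenioidData.ofFunctor (trivialMonoidOn G (Multiplicative ℕ)) F).IsDivSlim :=
  PreFrobenioidData.not_isDivSlim_singleObj_of_pull_eq_self G _ fun _ _ _ => rfl

end Literature.AlgebraicGeometry.Frobenioids
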